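import Literature.MathematicalPhysics.QuantumFieldTheory.Balaban1983to89.Node00.TorusCoverLandau153CubeDomains
import Literature.MathematicalPhysics.QuantumFieldTheory.Balaban1983to89.B6SectAOperatorsV1

/-!
# NODE 00 — [Balaban1985Variational] (153) AT THE RECORD'S TORUS IN lit-balaban's V1 LETTERS: `R ∂*a = 0`, i.e. `RE D η⁻¹ (dsE η⁻¹ a) = 0` for
# `D = cubeDomains` (the datum's own torus tower), `a = Re ∕ Im(φ ∘ A)` the real components of the pushed-down potential — [Balaban1984PropagatorsII] (2.12)'s orthogonal
# projection `R` onto `ΔN(Q′)` (`B6SectAOperatorsV1.RE`), the last inch after `Node00.TorusCoverLandau153CubeDomains`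

Cell `pub-ymgap`, width seat `pub-ymgap-dag-n07-w3` generation 2, INTENT-5 (cell INBOX 2026-08-28).  EDITION v1.1 (generation 6, 2026-08-28; referee `pub-ymgap-dag-ref-L`
READ-272 NITs): the stray build-time `#print axioms` command at the end of the file removed and the ledger-facing sentences of this header updated (key ∕ count wording only) —
all three declarations and their docstrings byte-identical.  NEW leaf, PROOF kind (no `def`, no `instance`, no `notation`).  CONSUMED BY NAME, nothing
modified: this seat's FILE 4 `Node00.TorusCoverLandau153CubeDomains` (`sum_laplace_mul_diverg_re∕im_eq_zero_of_cubeDomains`, `exists_localGauge152_153_cubeDomains_of_gaugedBoundB8`);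
lit-balaban p21's `B6SectAOperatorsV1` (`ScalarSpace`, `RE`, `dsE`, `lapE`, `QpE`, `RE_eq_zero_iff`, `mem_ker_QpE_iff`, `lapE_apply`, `dsE_apply`, `inner_eq_sum`) and `BondSpace`
(`BIJ85AxialPropagator411`); dag-n07-e's `cubeDomains` (`Node00.TorusCoverCubeDomains`); N05's `CubeB8` ∕ `GaugedBoundB8` ∕ `IsLandau138`; r15's `cover`.
Filed `--kind proof --supports stmt-QuantumFields-20542` (K1⁷ — set `aside` by route `BalabanUVNodes` rev 27, whose K1-face item is K1⁸ `stmt-QuantumFields-26907`; the file is a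
count-neutral helper under either key).  [15] = [Balaban1985Variational]; [6] = [Balaban1985RegularSpaces]; [B6] = [Balaban1984PropagatorsII].

WHY.  The S4 consumer at the record (`pub-ymgap-k0-s1-w1`'s `…K0Stub1FlatHessianRGaugeCoercivityAtRecord`) displays [15] (153) in p21's letters `RE D c (dsE c a) = 0` — the
orthogonal projection onto `ΔN(Q′)` of [B6] (2.10)–(2.12) applied to the divergence of a REAL bond function `a` — for the real and imaginary parts of the entries of the
𝔰𝔲(N)-valued field.  FILE 4 delivers, for every gauge test function `μ ∈ N(Q′)` of the datum's torus tower `cubeDomains`, the pairing `Σ_y (laplace η⁻¹ μ)(y)·(diverg η⁻¹ a)(y) = 0`;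
p21's `RE_eq_zero_iff` («`R v = 0 ⇔ ⟪Δn, v⟫ = 0` for all `n ∈ ker Q′`»), `mem_ker_QpE_iff` (`ker Q′ = N(Q′)` as `InGauge`), `lapE_apply` ∕ `dsE_apply` (`Δ = laplace`, `∂* = diverg`
componentwise) and `inner_eq_sum` (the `ℓ²` pairing) make this LITERALLY `RE (cubeDomains …) η⁻¹ (dsE η⁻¹ a) = 0`.  THIS FILE writes that line (§1) and the capstone of FILE 4 in
the same letters (§2).

HONEST FRAMING: a composition by name (no estimate, no new definition); [6] Proposition 6 at the member is the HYPOTHESIS `hG`; non-wrapping of `□₀` and of the grid cube displayed;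
nothing of [15] ∕ [6] ∕ [B6] analysis asserted; N07 ∕ N05 ∕ K0⁷ ∕ K1⁷ ∕ K1⁸ NOT closed or discharged; the cell's typed ∕ discharged counts are not moved by this file (the chair's tally of
record is the only count); one finite 𝕋⁴ programme at fixed ε — R4 closes the conditional finite-𝕋⁴ rung `BalabanLadder.UV` only; the YM mass gap (Clay) is NOT proved by
any of this; nothing continuum ∕ ℝ⁴ ∕ infinite volume ∕ OS.
No `sorry`, no `def`, no `instance`, no `notation`.
-/

noncomputable section

namespace Literature.MathematicalPhysics.QuantumFieldTheory.Balaban1983to89.Node00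

open scoped Matrix.Norms.L2Operator InnerProductSpace RealInnerProductSpace
open B7Prop1Local (InBox)
open B8Eq131Cubes (box bLo bHi)
open B8Eq138LandauZd (IsLandau138)
open B15Eq112TorusCover (cover)
open B14DomainGeom (Pt)
open B14.Eq213MaximalDomains (cubeExt)
open B12RegularSpaces111 (gaugeU expI grad)
open LatticeFieldCalculus (laplace diverg)
open B6SectAOperatorsV1 (ScalarSpace RE dsE lapE QpE RE_eq_zero_iff mem_ker_QpE_iff lapE_apply dsE_apply inner_eq_sum)
open BalabanImbrieJaffe1984to88.BIJ85AxialPropagator411 (BondSpace)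

variable {P : Params} {N : ℕ}

/-! ## §1  ★★★ `RE (cubeDomains c) η⁻¹ (dsE η⁻¹ a) = 0` for the real components of the pushed-down potential -/

section Last

/-- ★★★ **[15] (153) IN p21's LETTERS, REAL PART**: at a `CubeB8` datum `c` (`c.k ≤ m + K`, `□₀` non-wrapping) and a torus potential `A : PBond P 0 → M_N(ℂ)` carrying the sixth
conjunct «`∃ A′`, `A ⟨π x, μ⟩ = A′ x μ` on `□₀` ∧ `IsLandau138 L c.k η □₀ c.lamS 1 A′`», for every `φ : M_N(ℂ) →L[ℂ] ℂ` the real bond function `a := Re(φ ∘ A)` satisfies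
`R ∂*a = 0` with `R = RE (cubeDomains P c.a c.M c.ρ c.k _) η⁻¹` the orthogonal projection onto `ΔN(Q′)` of [B6] (2.12) for the datum's torus tower and `∂* = dsE η⁻¹`.
[cite: Balaban1985Variational, (153) p.301; Balaban1985RegularSpaces, (1.38) p.82, p.80; Balaban1984PropagatorsII, (2.7) p.224, (2.10)–(2.12) p.225] -/
theorem RE_dsE_re_eq_zero_of_cubeDomains {K' : ℕ} {Ω' : ℕ → Set (B7Prop1Explicit.Site P.d)} (c : CubeB8 P.d P.L K' Ω')
    (hck : c.k ≤ P.m + P.K) (hinj : Set.InjOn (cover P) (c.sq 0)) {η : ℝ} {A : PBond P 0 → MatA N}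
    (h6 : ∃ A' : B7Prop1Explicit.Site P.d → Fin P.d → MatA N,
        (∀ x, x ∈ c.sq 0 → ∀ μ, A ⟨cover P x, μ⟩ = A' x μ) ∧
        IsLandau138 P.L c.k η (c.sq 0) c.lamS (1 : B7Prop1Explicit.Site P.d → Fin P.d → (MatA N)ˣ) A')
    (φ : MatA N →L[ℂ] ℂ) :
    RE (cubeDomains P c.a c.M c.ρ c.k hck) η⁻¹ (dsE η⁻¹ (WithLp.toLp 2 fun b => (φ (A b)).re : BondSpace P)) = 0 := by
  rw [RE_eq_zero_iff]
  intro n hn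
  rw [mem_ker_QpE_iff] at hn
  rw [inner_eq_sum]
  simp_rw [lapE_apply, dsE_apply]
  exact sum_laplace_mul_diverg_re_eq_zero_of_cubeDomains c hck hinj h6 hn φ

/-- ★★★ **The same, IMAGINARY PART** (`a := Im(φ ∘ A)`). [cite: Balaban1985Variational, (153) p.301; Balaban1984PropagatorsII, (2.7) p.224, (2.12) p.225] -/
theorem RE_dsE_im_eq_zero_of_cubeDomains {K' : ℕ} {Ω' : ℕ → Set (B7Prop1Explicit.Site P.d)} (c : CubeB8 P.d P.L K' Ω')
    (hck : c.k ≤ P.m + P.K) (hinj : Set.InjOn (cover P) (c.sq 0)) {η : ℝ} {A : PBond P 0 → MatA N}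
    (h6 : ∃ A' : B7Prop1Explicit.Site P.d → Fin P.d → MatA N,
        (∀ x, x ∈ c.sq 0 → ∀ μ, A ⟨cover P x, μ⟩ = A' x μ) ∧
        IsLandau138 P.L c.k η (c.sq 0) c.lamS (1 : B7Prop1Explicit.Site P.d → Fin P.d → (MatA N)ˣ) A')
    (φ : MatA N →L[ℂ] ℂ) :
    RE (cubeDomains P c.a c.M c.ρ c.k hck) η⁻¹ (dsE η⁻¹ (WithLp.toLp 2 fun b => (φ (A b)).im : BondSpace P)) = 0 := by
  rw [RE_eq_zero_iff]
  intro n hn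
  rw [mem_ker_QpE_iff] at hn
  rw [inner_eq_sum]
  simp_rw [lapE_apply, dsE_apply]
  exact sum_laplace_mul_diverg_im_eq_zero_of_cubeDomains c hck hinj h6 hn φ

end Last

/-! ## §2  ★★★ The capstone in p21's letters: [6] Proposition 6 at the member ⟹ (152) letters on a grid cube and `R ∂*a = 0` for the same potential -/

section Capstone

variable [NeZero N]

/-- ★★★ **[6] PROPOSITION 6 AT NODE 00's `ℤᵈ` MEMBER ⟹ THE LOCAL GAUGE OF [15] (152) ON A GRID CUBE WITH ITS FOUR LETTERS, AND (153) `R ∂*a = 0` IN p21's LETTERS FOR EVERY REAL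
COMPONENT `a = Re ∕ Im(φ ∘ A)` OF THE SAME POTENTIAL** — FILE 4's `exists_localGauge152_153_cubeDomains_of_gaugedBoundB8` (same hypotheses BYTE FOR BYTE: `d ≥ 2`; `CubeB8` datum
`c`, `c.k = n ≤ m + K`, `Set.InjOn (cover P) (c.sq 0)`; `0 ≤ r`, `GaugedBoundB8 L η_n (zdLift N U) c r` (the HYPOTHESIS); non-wrapping grid cube `cubeExt S a 0 ⊆ box`; the
`2π`-window) with the last conjunct in the letters `RE (cubeDomains …) η_n⁻¹ (dsE η_n⁻¹ a) = 0`.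
[cite: Balaban1985Variational, (144)–(153) pp.300–301; Balaban1985RegularSpaces, Prop. 6 (1.135)–(1.138) p.99, (1.38) p.82; Balaban1984PropagatorsII, (2.10)–(2.12) p.225; Balaban1987RG1, (0.1) p.251] -/
theorem exists_localGauge152_RE153_cubeDomains_of_gaugedBoundB8 (hd : 2 ≤ P.d) {K' : ℕ} {Ω' : ℕ → Set (B7Prop1Explicit.Site P.d)} (c : CubeB8 P.d P.L K' Ω')
    (U : GaugeField P 0 (SU N)) {n : ℕ} (hk : c.k = n) (hn : n ≤ P.m + P.K) (hinj : Set.InjOn (cover P) (c.sq 0)) {r : ℝ} (hr : 0 ≤ r)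
    (hG : letI : CStarAlgebra (MatA N) := {}; GaugedBoundB8 P.L (P.eta n) (zdLift N U) c r)
    {S : ℕ} {a : Pt P.d} (hSN : (S : ℤ) < P.sitesPerDir 0) (hbox : cubeExt S a 0 ⊆ box P.L c.a c.M c.k)
    (h2π : (2 * boxWidth (bLo P.L c.a c.k 0) (bHi P.L c.a c.M c.k 0) + 1) * (P.eta n * N * (r * ((P.L : ℝ) ^ c.k * P.eta n)⁻¹)) < 2 * Real.pi) :
    ∃ u : GaugeTransf P 0 (SU N), ∃ A : PBond P 0 → MatA N,
      (∀ b ∈ (Sect2.regionOfSet P (cubeEnl P S a 0)).bonds, gaugeU (fun x => ιSU N (u x)) (fun b' => ιSU N (U b')) b = expI (P.eta n) (A b)) ∧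
      (∀ b ∈ (Sect2.regionOfSet P (cubeEnl P S a 0)).bonds, ‖A b‖ ≤ 2 * r) ∧
      (∀ q ∈ (Sect2.regionOfSet P (cubeEnl P S a 0)).dpairs, ‖grad (P.eta n) q.2.1 (fun y => A ⟨y, q.2.2⟩) q.1‖ ≤ 2 * r) ∧
      (∀ b ∈ Sect2.bondsDeep (cubeEnl P S a 0), ‖Sect2.codiffCurlA (P.eta n) A b.src b.dir‖ ≤ 2 * r) ∧
      (∀ b ∈ Sect2.bondsDeep (cubeEnl P S a 0),
          ‖∑ ν : Fin P.d, ((P.eta n : ℝ) : ℂ)⁻¹ •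
              (grad (P.eta n) ν (fun y => A ⟨y, b.dir⟩) (b.src.unshift ν) - grad (P.eta n) ν (fun y => A ⟨y, b.dir⟩) b.src)‖ ≤ 2 * r) ∧
      (∀ φ : MatA N →L[ℂ] ℂ,
          RE (cubeDomains P c.a c.M c.ρ c.k (hk ▸ hn)) (P.eta n)⁻¹ (dsE (P.eta n)⁻¹ (WithLp.toLp 2 fun b => (φ (A b)).re : BondSpace P)) = 0 ∧
          RE (cubeDomains P c.a c.M c.ρ c.k (hk ▸ hn)) (P.eta n)⁻¹ (dsE (P.eta n)⁻¹ (WithLp.toLp 2 fun b => (φ (A b)).im : BondSpace P)) = 0) := by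
  have hXX' : cubeExt S a 0 ⊆ c.sq 0 := hbox.trans (box_subset_sq_zero c)
  obtain ⟨u, A, h1, h2, h3, h4, h5, h6⟩ := exists_localGauge152_153_window₂_of_gaugedBoundB8 hd c U hk hr hG hXX' hinj
    (fun x hx μ h => add_e_mem_cubeExt_of_shift_mem_image hSN hx h) (fun x hx ν h => sub_e_mem_cubeExt_of_unshift_mem_image hSN hx h) hbox h2π
  have e0 : cubeEnl P S a 0 = cover P '' cubeExt S a 0 := by simp only [cubeEnl, Nat.zero_mul, Nat.cast_zero]
  rw [e0]
  exact ⟨u, A, h1, h2, h3, h4, h5, fun φ =>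
    ⟨RE_dsE_re_eq_zero_of_cubeDomains c (hk ▸ hn) hinj h6 φ, RE_dsE_im_eq_zero_of_cubeDomains c (hk ▸ hn) hinj h6 φ⟩⟩

end Capstone

end Literature.MathematicalPhysics.QuantumFieldTheory.Balaban1983to89.Node00

end
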